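import Literature.NumberTheory.EllipticCurves.HeegnerGeomTowerRecurrenceProofs
import HarnessLib

/-!
# Re-layering: `K_k · K[p^{d-1}] = K[p^d]` when `K_k ⊆ K[p^d]` but `K_k ⊄ K[p^{d-1}]` (`d ≥ 2`), read on `Γ_K`
# (CGLS 2022 §4.1, proof of Thm. 4.1.1 / Rem. 4.1.4; Howard 2004 §3.3), via `[K[p^d] : K[p^{d-1}]] = p`

Topic `NumberTheory/EllipticCurves` (complex multiplication / Heegner points). THEOREMS ONLY (no definition,
no named fact; net Literature debt `0`). Cell `bsd-print-x9`, seat x9-p1 (LEAD; envelope infrastructure part IV-b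
for the cruxes stmt-BirchSwinnertonDyer-25235 / -26359). CGLS build the `α`-stabilised class at the layer `K_k`
from the norm points `u_k = Norm_{K[p^{d(k)}]/K_k} P[p^{d(k)}]` and `v_k = Norm_{K_kK[p^{d(k)-1}]/K_k} P[p^{d(k)-1}]`
with `d(k) = min {d : K_k ⊆ K[p^d]}`; that `v_k` is a norm over the SAME Galois set as `u_k` is the field identity
`K_kK[p^{d-1}] = K[p^d]`, i.e. on `Γ_K`: `Gal(K̄/K_k) ∩ Gal(K̄/K[p^{d-1}]) = Gal(K̄/K[p^d])`, which holds because
`[K[p^d] : K[p^{d-1}]] = p` is prime (Cox Cor. 7.28). Proved here for the tree's `ringClassSubgroup` and ANY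
subgroup `Λ` in place of `Gal(K̄/K_k)` (`inf_ringClassSubgroup_eq_of_not_le`), from the `p`-element transversal of
`HeegnerGeomTowerRecurrenceProofs` read as a relative index (`relIndex_eq_card_of_transversal`,
`relIndex_ringClassSubgroup_eq_prime`) and the multiplicativity of relative indices. HONEST FRAMING: Galois
bookkeeping only; nothing on `L`-functions, Selmer groups or BSD is asserted. References: [CastellaGrossiLeeSkinner2022]
§4.1 (d(k), K_k[n]); [Howard2004HeegnerKolyvagin] §3.3; [Cox2013] §7.D Cor. 7.28; [GrossLMS1991] §3.
-/

set_option autoImplicit false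

noncomputable section

open scoped Classical

namespace Literature.NumberTheory.EllipticCurves

open WeierstrassCurve RingClassField

variable {K : Type} [Field K] [NumberField K]

/-! ## Relative indices from finite transversals, and the re-layering lemma -/

section RelIndex

variable {Γ : Type*} [Group Γ]

/-- **The relative index `[L : H ∩ L]` is the size of any finite transversal of `H` in `L`** (the tree's
transversal shape `∀ τ ∈ L, ∃! r ∈ R, r⁻¹τ ∈ H`, with `H ≤ L`). [cite: GrossLMS1991, §3 (#G_ℓ as the number of conjugates)] -/
theorem relIndex_eq_card_of_transversal {H L : Subgroup Γ} {R : Finset Γ}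
    (hR : ∀ r ∈ R, r ∈ L) (htR : ∀ τ ∈ L, ∃! r, r ∈ R ∧ r⁻¹ * τ ∈ H) :
    H.relIndex L = R.card := by
  classical
  -- the transversal as a subset of `L`
  let S : Set L := {s | (s : Γ) ∈ R}
  have hS : Subgroup.IsComplement S (H.subgroupOf L : Set L) := by
    rw [Subgroup.isComplement_iff_existsUnique_inv_mul_mem]
    intro g
    obtain ⟨r, ⟨hrR, hrH⟩, huniq⟩ := htR g g.2
    refine ⟨⟨⟨r, hR r hrR⟩, hrR⟩, ?_, ?_⟩
    · show ((⟨r, hR r hrR⟩ : L)⁻¹ * g) ∈ (H.subgroupOf L : Set L)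
      rw [SetLike.mem_coe, Subgroup.mem_subgroupOf]
      exact hrH
    · rintro ⟨⟨s, hsL⟩, hsR⟩ hs
      rw [SetLike.mem_coe, Subgroup.mem_subgroupOf] at hs
      have h := huniq s ⟨hsR, hs⟩
      subst h
      rfl
  rw [Subgroup.relIndex, ← hS.card_left]
  -- `Nat.card S = R.card`
  have e : S ≃ (R : Set Γ) :=
    { toFun := fun s ↦ ⟨(s.1 : Γ), Finset.mem_coe.mpr s.2⟩
      invFun := fun r ↦ ⟨⟨r.1, hR r.1 (Finset.mem_coe.mp r.2)⟩, Finset.mem_coe.mp r.2⟩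
      left_inv := fun _ ↦ rfl
      right_inv := fun _ ↦ rfl }
  rw [Nat.card_congr e, Nat.card_coe_set_eq, Set.ncard_coe_finset]

end RelIndex

/-- **`[Gal(K̄/K[m]) : Gal(K̄/K[pm])] = p` for `p ∣ m`** (`[K[pm] : K[m]] = p`, Cox Cor. 7.28, read on `Γ_K`).
[cite: Cox2013, §7.D Cor. 7.28] -/
theorem relIndex_ringClassSubgroup_eq_prime (hK : IsImaginaryQuadratic K) (jbar : AlgebraicClosure K →+* ℂ)
    {p m : ℕ} (hp : p.Prime) (hpm : p ∣ m) (hm : m ≠ 0) :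
    (ringClassSubgroup K (p * m) jbar).relIndex (ringClassSubgroup K m jbar) = p := by
  obtain ⟨S, hS, htS, hcard⟩ := exists_transversal_ringClassSubgroup_card_eq hK jbar hp hpm hm
  rw [relIndex_eq_card_of_transversal hS htS, hcard]

/-- **Re-layering** (CGLS 2022 §4.1 / Howard 2004 §3.3: `K_k · K[p^{d-1}] = K[p^d]` when `K_k ⊆ K[p^d]` but
`K_k ⊄ K[p^{d-1}]`, `d ≥ 2`, because `[K[p^d] : K[p^{d-1}]] = p` is prime): for any subgroup `Λ ≤ Γ_K` with
`Gal(K̄/K[p^d]) ≤ Λ` and `Gal(K̄/K[p^{d-1}]) ≰ Λ`, `Λ ⊓ Gal(K̄/K[p^{d-1}]) = Gal(K̄/K[p^d])` — so a transversal of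
`Gal(K̄/K[p^d])` in `Λ` is also one of `Gal(K̄/K[p^{d-1}])` (the tree's `v_k` norm points of `StabilizedHeegnerData`
share the transversal of the `u_k`). [cite: CastellaGrossiLeeSkinner2022, Thm. 4.1.1 proof (d(k), K_k[n]) and Rem. 4.1.4]
[cite: Howard2004HeegnerKolyvagin, §3.3] -/
theorem inf_ringClassSubgroup_eq_of_not_le (hK : IsImaginaryQuadratic K) (jbar : AlgebraicClosure K →+* ℂ)
    {p : ℕ} (hp : p.Prime) {d : ℕ} (hd : 2 ≤ d) {Λ : Subgroup (Field.absoluteGaloisGroup K)}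
    (hle : ringClassSubgroup K (p ^ d) jbar ≤ Λ) (hnot : ¬ ringClassSubgroup K (p ^ (d - 1)) jbar ≤ Λ) :
    Λ ⊓ ringClassSubgroup K (p ^ (d - 1)) jbar = ringClassSubgroup K (p ^ d) jbar := by
  obtain ⟨e, rfl⟩ : ∃ e, d = e + 2 := ⟨d - 2, by omega⟩
  have hsub : e + 2 - 1 = e + 1 := by omega
  rw [hsub] at hnot ⊢
  have hm : p ^ (e + 1) ≠ 0 := pow_ne_zero _ hp.ne_zero
  have hpm : p ∣ p ^ (e + 1) := dvd_pow_self p (Nat.succ_ne_zero e)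
  have hpe : p * p ^ (e + 1) = p ^ (e + 2) := by rw [← pow_succ']
  set H := Λ ⊓ ringClassSubgroup K (p ^ (e + 1)) jbar with hH
  have hanti : ringClassSubgroup K (p ^ (e + 2)) jbar ≤ ringClassSubgroup K (p ^ (e + 1)) jbar :=
    ringClassSubgroup_anti hK jbar (pow_dvd_pow p (Nat.le_succ _)) (pow_ne_zero _ hp.ne_zero)
  have h1 : ringClassSubgroup K (p ^ (e + 2)) jbar ≤ H := le_inf hle hanti
  have h2 : H ≤ ringClassSubgroup K (p ^ (e + 1)) jbar := inf_le_right
  have hprod := Subgroup.relIndex_mul_relIndex (ringClassSubgroup K (p ^ (e + 2)) jbar) H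
    (ringClassSubgroup K (p ^ (e + 1)) jbar) h1 h2
  have hidx : (ringClassSubgroup K (p ^ (e + 2)) jbar).relIndex (ringClassSubgroup K (p ^ (e + 1)) jbar) = p := by
    rw [← hpe]; exact relIndex_ringClassSubgroup_eq_prime hK jbar hp hpm hm
  rw [hidx] at hprod
  -- a factorisation of the prime `p`
  rcases (Nat.dvd_prime hp).mp (Dvd.intro _ hprod) with h | h
  · -- `[H : Gal(K̄/K[p^{e+2}])] = 1` ⇒ `H ≤ Gal(K̄/K[p^{e+2}])`
    exact le_antisymm (Subgroup.relIndex_eq_one.mp h) h1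
  · -- then `[Gal(K̄/K[p^{e+1}]) : H] = 1` ⇒ `Gal(K̄/K[p^{e+1}]) ≤ H ≤ Λ`: contradiction
    rw [h] at hprod
    have h1' : H.relIndex (ringClassSubgroup K (p ^ (e + 1)) jbar) = 1 :=
      (Nat.mul_right_inj hp.ne_zero).mp (hprod.trans (mul_one p).symm)
    exact absurd ((Subgroup.relIndex_eq_one.mp h1').trans inf_le_left) hnot

end Literature.NumberTheory.EllipticCurves

end
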